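import Summits.BirchSwinnertonDyer.BirchSwinnertonDyer.Theorems.KolyvaginRankRigidityAtTwoOppositeSignReciprocityCore
import HarnessLib

/-!
# Crux U1 `KolyvaginBoundedDefectAtTwo` (stmt-BirchSwinnertonDyer-28083), LINE 17 `kolyvagin_swap` — OSR
# `OppositeSignReciprocityAtTwo`, part 3/3: the frame DISCHARGED on the hybrid-transverse structures and **THE TYPED OSR
# (pen v7.7 l.543–568, VERBATIM) PROVED FROM ONE NAMED PRINT FACT** (Gross 1991 Prop. 3.7 (2) = the registered print stub P372)

Authored by the pen `bsd-idea-1` g15 (planner; HOME `line17/OppositeSignReciprocityAtTwo.lean` sha16 67c18ff6e0b42450, farm rc 0,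
critic #322 reproduced); landed (split into three files ≤ 400 lines, statements unchanged, §4's inline `def` dropped in favour of the
verbatim body) by width seat `bsd-line-krr2-p2` g18, `--supports stmt-BirchSwinnertonDyer-28083` (helper). THEOREMS ONLY; the end
result is CONDITIONAL on `prop37_2_frobeniusCongruence` (the registered print stub P372 of the line of record); nothing here proves
SWα, U1, a rung or BSD. BSD is NOT proved.
CONSEQUENCE FOR THE LINE: in v7.7's stub set {S0ʳ, LD, START, SWα⁗, OSR, SRS, P372} the stub OSR is DISCHARGED modulo P372 (v7.8:
`stub_oppositeSignReciprocityAtTwo := oppositeSignReciprocityAtTwo_of_frobeniusCongruence stub_heegnerCongruence`), and SRS is the tree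
theorem `KolyvaginAtTwo.RegularWalk.signedRefillSupplyAtTwo` (p723829); so Zζ `LoneSeedPartnerAtTwo` follows modulo P372 by the
pen's `loneSeedPartnerAtTwo_of`.

§3 `oppositeSignReciprocityAtTwo_core_hybrid` — the frame hypotheses P8 (`h𝒯sd`), P4, P7a, Q2, T2 of part 2 DISCHARGED on the
hybrid-transverse frame of `KolyvaginRankRigidityAtTwoSwapHybridFrameNine` (ring-class transverse condition at the Kolyvagin places of
index `≥ M+1`, Kummer elsewhere): P8 `dualTransported_eq_of_hybrid`, P4 `JET.localization_kolyvaginClass_mem_globalTransverse_two`,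
P7a `swapPairing_pow_smul_ne_zero_at_two_of_index` (c₇ = 2, index `≥ M+1`, NO Frobenius-class condition), Q2
`GenusExact.kolyvaginRelationAtTwo_of_frobeniusCongruence h37`, T2 `KolyvaginRankRigidity.pow_zsmul_kolyvaginClass_two_mem_selmerLocalKer`
(`t = |Δ_min| + 4`).  CONDITIONAL on `h37` only.
§4 `oppositeSignReciprocityAtTwo_of_frobeniusCongruence (h37) : <OSR body verbatim>` (constant `C = |Δ_min| + 6`): the frame is
BUILT (`τ² = 1`; Poitou–Tate families = the tree THEOREM `InputsPoitouTateSelmer.poitouTate_selmerStructure_duality_conj_holds`;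
`τ`-equivariant Weil data `exists_weilDatum_liftAut_two_pow`; hybrid structures `exists_hybridTransverseFamily`), the sibling currency is
bridged (`H_{𝓕(m)} = modifiedSelmerGroup = (selmerF 𝒯_M (placesDividing m)).selmerGroup` via JET's global transverse family and
`selmerGroup_selmerF_eq_modifiedSelmerGroup`), and the SIGN SQUEEZE is done with the kernel sign law `sign_conjAct_kolyvaginClass_two`
(`ε(nℓ) = −ε(n)`; if the visible sign `u` of `c_M(n)` is not `ε(n)` then `2·c_M(n) = 0`, so `b = 0`, so `a ≥ M`, contradicting
`2^a z ∉ ker loc_v`).  The statement of §4 is the pen's `OppositeSignReciprocityAtTwo` (v7.7 55dfebd9 l.543–568 = v7.8) byte-for-byte;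
no `def` is declared here (when the skeleton's Prop is in scope the stub closes by `exact … stub_heegnerCongruence`).
References (locators only; no cited FACT is declared): [cite: Kolyvagin1991MathAnn, §2 Thm. 2.2 (p. 257)]
[cite: GrossLMS1991, Prop. 3.7 (2), §5 Prop. 5.4] [cite: McCallumLMS1991, §5 Prop. 5.2, Lemma 5.3] [cite: WZhang2014, Lemma 8.2, Lemma 8.4]
[cite: MilneADT2006, Ch. I, Thm. 4.10].
Design: no definitions; `K : Type`; axioms `propext`, `Classical.choice`, `Quot.sound`.
-/

set_option autoImplicit false
-- the Theorems namespace of this sub repeats the summit name by design (D-0017 nested layout)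
set_option linter.dupNamespace false

noncomputable section

open scoped Classical Pointwise
open Function NumberField IsDedekindDomain WeierstrassCurve Field
open Literature.NumberTheory.EllipticCurves Literature.NumberTheory.GaloisRepresentations
open Literature.NumberTheory.EllipticCurves.Jetchev2008 Literature.NumberTheory.EllipticCurves.ModularForms
open Literature.NumberTheory.GaloisCohomology
open Literature.NumberTheory.GaloisRepresentations.DiscreteGaloisModule (localTatePairingZMod
  tateDual SelmerStructure)
open Summit.BirchSwinnertonDyer.Rank1Residual.JET.SelmerVocabulary
open Summit.BirchSwinnertonDyer.Rank1Residual.JET.GlobalDuality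

namespace Summit.BirchSwinnertonDyer.BirchSwinnertonDyer.Theorems.KolyvaginLowerBoundAtTwo

open Summit.BirchSwinnertonDyer.BirchSwinnertonDyer.Theses.KolyvaginRankRigidityAtTwo
open Summit.BirchSwinnertonDyer.BirchSwinnertonDyer.Theses.GenusKolyvaginAtTwo (KolyvaginRelationAtTwo)
open Literature.NumberTheory.GaloisRepresentations.DiscreteGaloisModule (transverseSubgroup)
open Literature.NumberTheory.Automorphic
open Summit.BirchSwinnertonDyer.Rank1Residual
open Literature.NumberTheory.EllipticCurves.GrossLMS1991 (prop37_2_frobeniusCongruence)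

section HybridFrame

variable {K : Type} [Field K] [NumberField K] (W : WeierstrassCurve ℚ) [W.IsElliptic]
  [W.IsGloballyMinimal] [(W.baseChange K).IsElliptic] [NeZero (W.conductorNorm ℤ)]
  [∀ M : ℕ, NeZero (2 ^ M)] [∀ M : ℕ, Finite (geomTorsion (W.baseChange K) ((2 ^ M : ℕ) : ℤ))]
  (τ : K ≃ₐ[ℚ] K)
  (Dt : ModularParametrizationData W (W.conductorNorm ℤ)) (β : ℤ) (ι : K →+* ℂ)
  [∀ j : ℕ, NumberField (ringClassField K ι j)]
  (e : ∀ M : ℕ, geomTorsion (W.baseChange K) ((2 ^ M : ℕ) : ℤ) →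
    geomTorsion (W.baseChange K) ((2 ^ M : ℕ) : ℤ) → AlgebraicClosure K)
  (hμ : ∀ M S T, e M S T ^ (2 ^ M) = 1)
  (hadd₁ : ∀ M S₁ S₂ T, e M (S₁ + S₂) T = e M S₁ T * e M S₂ T)
  (hadd₂ : ∀ M S T₁ T₂, e M S (T₁ + T₂) = e M S T₁ * e M S T₂)
  (hgal : ∀ M (g : absoluteGaloisGroup K) (S T : geomTorsion (W.baseChange K) ((2 ^ M : ℕ) : ℤ)),
    g • e M S T = e M (g • S) (g • T))
  (halt : ∀ M T, e M T T = 1) (hnondeg : ∀ M T, (∀ S, e M S T = 1) → T = 0)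
  (hτe : ∀ (M : ℕ) S T, liftAut τ (e M S T) =
    e M ((isLiftOfAut_liftAut τ).torsionMap W ((2 ^ M : ℕ) : ℤ) S)
      ((isLiftOfAut_liftAut τ).torsionMap W ((2 ^ M : ℕ) : ℤ) T))
  (inv : ∀ M : ℕ, LocalInvariants K (2 ^ M))
  (𝒯 : ∀ M : ℕ, SelmerStructure ((W.baseChange K).torsionGaloisModule ((2 ^ M : ℕ) : ℤ)))
  -- the habitat
  (hCM : ¬ W.HasCM) (hsur : ∀ m : ℕ, W.HasSurjectiveModNGaloisRep (2 ^ m : ℕ)) (hK : IsImaginaryQuadratic K)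
  (hne3 : NumberField.discr K ≠ -3) (hne4 : NumberField.discr K ≠ -4)
  (hHN : SatisfiesHeegnerHypothesis (W.conductorNorm ℤ) K)
  (hτ1 : τ ≠ 1) (hττ : τ * τ = 1)
  (hperf : ∀ M, (inv M).IsPerfect) (hvan : ∀ M, (inv M).SumLocalTermEqZero)
  (hinvc : ∀ M, (inv M).IsConjCompatible τ)
  -- the hybrid transverse structures: ring-class transverse at Kolyvagin places of index ≥ M + 1, Kummer elsewhere
  (hTko : ∀ (M : ℕ) (v : HeightOneSpectrum (𝓞 K)) (q : ℕ),
    Zhang2014.IsKolyvaginPrime (W.conductorNorm ℤ) W K 2 q → M + 1 ≤ Zhang2014.kolyvaginIndex W 2 q →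
    (q : 𝓞 K) ∈ v.asIdeal →
    𝒯 M (Sum.inr v) = ⨅ (w' : HeightOneSpectrum (𝓞 (ringClassField K ι q)))
        (_ : w'.asIdeal.LiesOver v.asIdeal),
        letI := (adicCompletionOfLiesOver K (ringClassField K ι q) v w').toAlgebra
        transverseSubgroup (GaloisRep.toLocal v ((W.baseChange K).torsionGaloisModule ((2 ^ M : ℕ) : ℤ)))
          (w'.adicCompletion (ringClassField K ι q)))
  (hTku : ∀ (M : ℕ) (v : HeightOneSpectrum (𝓞 K)),
    (¬ ∃ q : ℕ, Zhang2014.IsKolyvaginPrime (W.conductorNorm ℤ) W K 2 q ∧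
        M + 1 ≤ Zhang2014.kolyvaginIndex W 2 q ∧ (q : 𝓞 K) ∈ v.asIdeal) →
    𝒯 M (Sum.inr v) = (W.baseChange K).kummerSelmerStructure ((2 ^ M : ℕ) : ℤ) (Sum.inr v))
  -- Q2's print input (Gross 1991 Prop. 3.7 (2), image-free form)
  (h37 : prop37_2_frobeniusCongruence)

include hμ hadd₁ hadd₂ hgal halt hnondeg hτe hCM hsur hK hne3 hne4 hHN hτ1 hττ hperf hvan hinvc hTko hTku h37 in
/-- **OSR core on the hybrid-transverse frame** — `oppositeSignReciprocityAtTwo_core` with P8 (`h𝒯sd`), P4, P7a (`c₇ = 2`), Q2, T2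
(`t = |Δ_min| + 4`) discharged by landed theorems; CONDITIONAL on Gross 1991 Prop. 3.7 (2) (`h37`).  The relative-order
condition reads `j + M + (|Δ_min| + 4 + 2) ≤ a + b + 1`. [cite: Kolyvagin1991MathAnn, §2 Thm. 2.2 (p. 257)]
[cite: McCallumLMS1991, §5 Prop. 5.2, Lemma 5.3] [cite: WZhang2014, Lemma 8.2, Lemma 8.4] [cite: GrossLMS1991, Prop. 3.7 (2)] -/
theorem oppositeSignReciprocityAtTwo_core_hybrid {M m n ℓ a b j : ℕ} {ε : ℤ}
    (dat : KolyvaginHeegnerData Dt β ι n) (dup : KolyvaginHeegnerData Dt β ι (n * ℓ))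
    (z : galoisCohomology ((W.baseChange K).torsionGaloisModule ((2 ^ M : ℕ) : ℤ)) 1)
    (v : HeightOneSpectrum (𝓞 K))
    (hM : 1 ≤ M) (hn : Squarefree n)
    (hnK : ∀ q ∈ n.primeFactors, Zhang2014.IsKolyvaginPrime (W.conductorNorm ℤ) W K 2 q ∧
      M + 1 ≤ Zhang2014.kolyvaginIndex W 2 q)
    (hmn : m ∣ n) (hℓK : Zhang2014.IsKolyvaginPrime (W.conductorNorm ℤ) W K 2 ℓ) (hℓn : ¬ ℓ ∣ n)
    (hℓI : M + 1 ≤ Zhang2014.kolyvaginIndex W 2 ℓ) (hv : ((ℓ : ℕ) : 𝓞 K) ∈ v.asIdeal)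
    (hε : ε = 1 ∨ ε = -1)
    (hz : z ∈ (selmerF W ((2 ^ M : ℕ) : ℤ) (𝒯 M) (placesDividing K m)).selmerGroup)
    (hzτ : conjAct W τ ((2 ^ M : ℕ) : ℤ) z = ε • z)
    (hdupτ : conjAct W τ ((2 ^ M : ℕ) : ℤ) (dup.kolyvaginClass Nat.prime_two M) =
      ε • dup.kolyvaginClass Nat.prime_two M)
    (hza : ((2 ^ a : ℕ) : ℤ) • z ∉ (W.baseChange K).torsionLocalKer (v.adicCompletion K) ((2 ^ M : ℕ) : ℤ))
    (hcb : ((2 ^ b : ℕ) : ℤ) • dat.kolyvaginClass Nat.prime_two M ∉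
      (W.baseChange K).torsionLocalKer (v.adicCompletion K) ((2 ^ M : ℕ) : ℤ))
    (hab : j + M + ((minimalDiscriminantInt W).natAbs + 4 + 2) ≤ a + b + 1)
    (hσ : ∀ l' ∈ n.primeFactors, ∀ (x : ringClassField K ι n) (x' : ringClassField K ι (n * ℓ)),
      (x : ℂ) = x' → ((dup.σ l' x' : ringClassField K ι (n * ℓ)) : ℂ) = (dat.σ l' x : ℂ))
    (hS : ∀ s ∈ dat.S, ∃ s' ∈ dup.S, ∀ (x : ringClassField K ι n) (x' : ringClassField K ι (n * ℓ)),
      (x : ℂ) = x' → ((s' x' : ringClassField K ι (n * ℓ)) : ℂ) = (s x : ℂ))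
    (hS' : ∀ s' ∈ dup.S, ∃ s ∈ dat.S, ∀ (x : ringClassField K ι n) (x' : ringClassField K ι (n * ℓ)),
      (x : ℂ) = x' → ((s' x' : ringClassField K ι (n * ℓ)) : ℂ) = (s x : ℂ))
    (hemb : ∀ (x : ringClassField K ι n) (x' : ringClassField K ι (n * ℓ)), (x : ℂ) = x' →
      dup.emb x' = dat.emb x) :
    ∃ q ∈ (n / m).primeFactors, ∃ w : HeightOneSpectrum (𝓞 K), ((q : ℕ) : 𝓞 K) ∈ w.asIdeal ∧
      ((2 ^ j : ℕ) : ℤ) • dup.kolyvaginClass Nat.prime_two M ∉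
        selmerLocalKer (W.baseChange K) (w.adicCompletion K) ((2 ^ M : ℕ) : ℤ) := by
  classical
  haveI : Fact (Nat.Prime 2) := ⟨Nat.prime_two⟩
  have hD : NumberField.discr K < -4 := X11b.KolyvaginAssembly.discr_lt_neg_four hK ⟨hne3, hne4⟩
  have hinj : ∀ (M : ℕ) (v : HeightOneSpectrum (𝓞 K)), Injective (inv M (Sum.inr v)) :=
    fun M v ↦ ((hperf M) v).1.injective
  -- P8: self-duality of the hybrid structure at every finite place
  have h𝒯sd : ∀ (M c : ℕ), ∀ v ∈ placesDividing K c,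
      (inv M).dualTransported (𝒯 M) (weilDualIntertwining (W.baseChange K) (2 ^ M) (e M) (hμ M) (hadd₁ M)
        (hadd₂ M) (hgal M)) (Sum.inr v) = 𝒯 M (Sum.inr v) := fun M c ↦
    dualTransported_eq_of_hybrid W M (e M) (hμ M) (hadd₁ M) (hadd₂ M) (hgal M) (halt M) (hnondeg M) (inv M)
      (𝒯 M) hK hD ι (hinj M) (fun v ↦ by
        by_cases h : ∃ q : ℕ, Zhang2014.IsKolyvaginPrime (W.conductorNorm ℤ) W K 2 q ∧
            M + 1 ≤ Zhang2014.kolyvaginIndex W 2 q ∧ (q : 𝓞 K) ∈ v.asIdeal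
        · obtain ⟨q, hq, hMq, hqv⟩ := h
          exact Or.inl ⟨q, hq, hMq, hqv, hTko M v q hq hMq hqv⟩
        · exact Or.inr (hTku M v h)) c
  -- P4: transversality at the primes of the conductor (unconditional at 2, margin one)
  have hP4 : ∀ (M c : ℕ) (dat : KolyvaginHeegnerData Dt β ι c),
      KolyvaginDescent.KolSupp (Zhang2014.IsKolyvaginPrime (W.conductorNorm ℤ) W K 2) c → 1 ≤ M →
      (∀ q ∈ c.primeFactors, M + 1 ≤ Zhang2014.kolyvaginIndex W 2 q) →
      ∀ w ∈ placesDividing K c,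
        galoisCohomology.localization ((W.baseChange K).torsionGaloisModule ((2 ^ M : ℕ) : ℤ)) (Sum.inr w) 1
          (dat.kolyvaginClass Nat.prime_two M) ∈ 𝒯 M (Sum.inr w) := by
    intro M c dat hc _ hcM w hw
    obtain ⟨𝒯g, h𝒯g, -⟩ := JET.Walk.exists_globalTransverseFamily W ι ((2 ^ M : ℕ) : ℤ)
    have hmem := JET.localization_kolyvaginClass_mem_globalTransverse_two W hK hD Dt β ι M h𝒯g dat hc hcM w hw
    obtain ⟨q, hqc, hqw⟩ := (natCast_mem_iff_exists_primeFactor_mem hc.1.ne_zero w).mp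
      ((mem_placesDividing_iff_natCast_mem hc.1.ne_zero w).mp hw)
    rw [hTko M w q (hc.2 q hqc) (hcM q hqc) hqw, ← JET.Walk.globalTransverse_eq_of_natCast_mem h𝒯g w
      (Nat.prime_of_mem_primeFactors hqc) hqw]
    exact hmem
  -- P7a (global, c₇ = 2, index ≥ M + 1, numerics only)
  have hP7a := swapPairing_pow_smul_ne_zero_at_two_of_index W τ e hμ hadd₁ hadd₂ hgal halt hnondeg inv hK hτ1
    hττ hτe hinj hinvc
  -- Q2 by name from Gross 3.7 (2); T2 with t = |Δ_min| + 4
  have hQ2 : KolyvaginRelationAtTwo := GenusExact.kolyvaginRelationAtTwo_of_frobeniusCongruence h37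
  have hT2 : ∀ (n : ℕ) (d : KolyvaginHeegnerData Dt β ι n) (M : ℕ),
      KolyvaginDescent.KolSupp (Zhang2014.IsKolyvaginPrime (W.conductorNorm ℤ) W K 2) n →
      1 ≤ M → (M : ℕ∞) ≤ Zhang2014.levelIndex W 2 n →
      ∀ v : HeightOneSpectrum (𝓞 K), ((n : ℕ) : 𝓞 K) ∉ v.asIdeal →
        ((2 ^ ((minimalDiscriminantInt W).natAbs + 4) : ℕ) : ℤ) • d.kolyvaginClass Nat.prime_two M ∈
          selmerLocalKer (W.baseChange K) (v.adicCompletion K) ((2 ^ M : ℕ) : ℤ) :=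
    fun n d M hn _ _ v hv ↦
      KolyvaginRankRigidity.pow_zsmul_kolyvaginClass_two_mem_selmerLocalKer W hK hHN hn.1.ne_zero d M v hv
  exact oppositeSignReciprocityAtTwo_core (W := W) (τ := τ) (Dt := Dt) (β := β) (ι := ι) (e := e) (hμ := hμ)
    (hadd₁ := hadd₁) (hadd₂ := hadd₂) (hgal := hgal) (halt := halt) (hnondeg := hnondeg) (inv := inv)
    (𝒯 := 𝒯) (hCM := hCM) (hsur := hsur) (hK := hK) (hne3 := hne3) (hne4 := hne4) (hHN := hHN)
    (hperf := hperf) (hvan := hvan) (h𝒯sd := h𝒯sd) (hP4 := hP4) (hP7a := hP7a) (hQ2 := hQ2) (hT2 := hT2)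
    dat dup z v hM hn hnK hmn hℓK hℓn hℓI hv hε hz hzτ hdupτ hza hcb hab hσ hS hS' hemb

end HybridFrame

/-! ## §4 The typed OSR (v7.7 l.543, verbatim) from Gross 1991 Prop. 3.7 (2) -/

section Typed

/-- `u • x = s • x` for two DIFFERENT signs `u, s ∈ {±1}` forces `2 • x = 0`. [folklore] -/
theorem two_zsmul_eq_zero_of_sign_mismatch {A : Type*} [AddCommGroup A] {u s : ℤ} {x : A}
    (hu : u = 1 ∨ u = -1) (hs : s = 1 ∨ s = -1) (hus : u ≠ s) (h : u • x = s • x) : (2 : ℤ) • x = 0 := by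
  rcases hu with rfl | rfl <;> rcases hs with rfl | rfl
  · exact absurd rfl hus
  · rw [one_zsmul, neg_one_zsmul] at h
    rw [two_zsmul]
    nth_rw 2 [h]
    exact add_neg_cancel x
  · rw [neg_one_zsmul, one_zsmul] at h
    rw [two_zsmul]
    nth_rw 1 [← h]
    exact neg_add_cancel x
  · exact absurd rfl hus

variable {K : Type} [Field K] [NumberField K]

/-- **OSR from Gross 1991 Prop. 3.7 (2).**  The typed stub OSR of LINE 17 v7.7 holds for every curve of U1's habitat, CONDITIONALLY on the one
named print fact `prop37_2_frobeniusCongruence` (= the line's registered stub P372), with the constant `C = |Δ_min(E)| + 6`: frame built from tree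
theorems (Poitou–Tate duality for finite Selmer structures, `τ`-equivariant Weil data, hybrid transverse structures), sibling currency bridged
(`H_{𝓕(m)} = H¹_{selmerF 𝒯_M (placesDividing m)}`), sign squeeze by the kernel sign law, then `oppositeSignReciprocityAtTwo_core_hybrid`.
HONEST: conditional-result (on `h37`); SWα⁗, U1, R2, BSD are NOT proved. [cite: Kolyvagin1991MathAnn, §2 Thm. 2.2 (p. 257)]
[cite: GrossLMS1991, Prop. 3.7 (2), §5 Prop. 5.4] [cite: McCallumLMS1991, §5 Prop. 5.2] [cite: MilneADT2006, Ch. I, Thm. 4.10] -/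
theorem oppositeSignReciprocityAtTwo_of_frobeniusCongruence (h37 : prop37_2_frobeniusCongruence) :
    ∀ (W : WeierstrassCurve ℚ) [W.IsElliptic] [W.IsGloballyMinimal], ¬ W.HasCM → (Literature.NumberTheory.EllipticCurves.Rank1Residual.GoodOrd W 2 ∨ Literature.NumberTheory.EllipticCurves.Rank1Residual.Mult W 2) → (∀ m : ℕ, W.HasSurjectiveModNGaloisRep (2 ^ m : ℕ)) → ∀ (K : Type) [Field K] [NumberField K], Literature.NumberTheory.EllipticCurves.IsImaginaryQuadratic K → ∀ [NeZero (W.conductorNorm ℤ)], Literature.NumberTheory.EllipticCurves.SatisfiesHeegnerHypothesis (W.conductorNorm ℤ) K → Odd (NumberField.discr K) → NumberField.discr K ≠ -3 → AddSubgroup.torsionBy (W.baseChange K).toAffine.Point (2 : ℤ) = ⊥ → Literature.NumberTheory.EllipticCurves.SatisfiesHeegnerHypothesis 2 K → ∀ (Dt : Literature.NumberTheory.EllipticCurves.ModularForms.ModularParametrizationData W (W.conductorNorm ℤ)) (β : ℤ) (ι : K →+* ℂ) [∀ k : ℕ, NumberField (ringClassField K ι k)], (4 * (W.conductorNorm ℤ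 : ℤ)) ∣ β ^ 2 - NumberField.discr K →
    ∀ (τ : K ≃ₐ[ℚ] K), τ ≠ 1 → ∀ (u : ℤ), (u = 1 ∨ u = -1) →
    ∃ C : ℕ, ∀ (M m n ℓ a b j : ℕ) (d : Literature.NumberTheory.EllipticCurves.KolyvaginHeegnerData Dt β ι n)
      (z : galH1Torsion (W.baseChange K) ((2 ^ M : ℕ) : ℤ)),
      Literature.NumberTheory.EllipticCurves.KolyvaginDescent.KolSupp (Literature.NumberTheory.EllipticCurves.Zhang2014.IsKolyvaginPrime (W.conductorNorm ℤ) W K 2) n →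
      1 ≤ M → (((M + 1 : ℕ) : ℕ) : ℕ∞) ≤ Literature.NumberTheory.EllipticCurves.Zhang2014.levelIndex W 2 n → m ∣ n →
      z ∈ Jetchev2008.modifiedSelmerGroup W K ι ((2 ^ M : ℕ) : ℤ) m →
      conjAct W τ ((2 ^ M : ℕ) : ℤ) z = (-u) • z →
      conjAct W τ ((2 ^ M : ℕ) : ℤ) (d.kolyvaginClass Nat.prime_two M) = u • d.kolyvaginClass Nat.prime_two M →
      Literature.NumberTheory.EllipticCurves.Zhang2014.IsKolyvaginPrime (W.conductorNorm ℤ) W K 2 ℓ → ¬ ℓ ∣ n →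
      M + 1 ≤ Literature.NumberTheory.EllipticCurves.Zhang2014.kolyvaginIndex W 2 ℓ →
      ∀ (v : IsDedekindDomain.HeightOneSpectrum (NumberField.RingOfIntegers K)), (ℓ : NumberField.RingOfIntegers K) ∈ v.asIdeal →
      ((2 ^ a : ℕ) : ℤ) • z ∉ (W.baseChange K).torsionLocalKer (v.adicCompletion K) ((2 ^ M : ℕ) : ℤ) →
      ((2 ^ b : ℕ) : ℤ) • d.kolyvaginClass Nat.prime_two M ∉ (W.baseChange K).torsionLocalKer (v.adicCompletion K) ((2 ^ M : ℕ) : ℤ) →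
      j + M + C ≤ a + b →
      ∀ (dup : Literature.NumberTheory.EllipticCurves.KolyvaginHeegnerData Dt β ι (n * ℓ)),
        (∀ l' ∈ n.primeFactors, ∀ (x : ringClassField K ι n) (x' : ringClassField K ι (n * ℓ)), (x : ℂ) = x' → ((dup.σ l' x' : ringClassField K ι (n * ℓ)) : ℂ) = (d.σ l' x : ℂ)) →
        (∀ t ∈ d.S, ∃ t' ∈ dup.S, ∀ (x : ringClassField K ι n) (x' : ringClassField K ι (n * ℓ)), (x : ℂ) = x' → ((t' x' : ringClassField K ι (n * ℓ)) : ℂ) = (t x : ℂ)) →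
        (∀ t' ∈ dup.S, ∃ t ∈ d.S, ∀ (x : ringClassField K ι n) (x' : ringClassField K ι (n * ℓ)), (x : ℂ) = x' → ((t' x' : ringClassField K ι (n * ℓ)) : ℂ) = (t x : ℂ)) →
        (∀ (x : ringClassField K ι n) (x' : ringClassField K ι (n * ℓ)), (x : ℂ) = x' → dup.emb x' = d.emb x) →
        ∃ q' ∈ (n / m).primeFactors, ∃ w : IsDedekindDomain.HeightOneSpectrum (NumberField.RingOfIntegers K),
          (q' : NumberField.RingOfIntegers K) ∈ w.asIdeal ∧
          ((2 ^ j : ℕ) : ℤ) • dup.kolyvaginClass Nat.prime_two M ∉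
            WeierstrassCurve.selmerLocalKer (W.baseChange K) (w.adicCompletion K) ((2 ^ M : ℕ) : ℤ) := by
  intro W _ _ hCM _hred hsur K _ _ hK _ hHN hodd hne3 _h2t _hH2 Dt β ι _ _hβ τ hτ1 u hu
  classical
  haveI : Fact (Nat.Prime 2) := ⟨Nat.prime_two⟩
  refine ⟨(minimalDiscriminantInt W).natAbs + 4 + 2, ?_⟩
  intro M m n ℓ a b j d z hnKol hM hlev hmn hz hzτ hcτ hℓK hℓn hℓI v hv hza hcb hab dup hσ hS hS' hemb
  have hne4 : NumberField.discr K ≠ -4 := by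
    intro h4
    rw [h4] at hodd
    have := Int.odd_iff.mp hodd
    omega
  have h2 : W.HasSurjectiveModNGaloisRep ((2 : ℤ) ^ 1) := by simpa using hsur 1
  -- (0) numerics of the conductors
  have hn : Squarefree n := hnKol.1
  have hn0 : n ≠ 0 := hn.ne_zero
  have hm0 : m ≠ 0 := fun h ↦ hn0 (Nat.eq_zero_of_zero_dvd (h ▸ hmn))
  have hnK : ∀ q ∈ n.primeFactors, Zhang2014.IsKolyvaginPrime (W.conductorNorm ℤ) W K 2 q ∧
      M + 1 ≤ Zhang2014.kolyvaginIndex W 2 q :=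
    fun q hq ↦ ⟨hnKol.2 q hq, Zhang2014.natCast_le_levelIndex_iff.mp hlev q hq⟩
  have hnK' : ∀ q ∈ n.primeFactors, Zhang2014.IsKolyvaginPrime (W.conductorNorm ℤ) W K 2 q ∧
      M ≤ Zhang2014.kolyvaginIndex W 2 q := fun q hq ↦ ⟨(hnK q hq).1, Nat.le_of_succ_le (hnK q hq).2⟩
  have hmK : ∀ q ∈ m.primeFactors, Zhang2014.IsKolyvaginPrime (W.conductorNorm ℤ) W K 2 q ∧
      M + 1 ≤ Zhang2014.kolyvaginIndex W 2 q := fun q hq ↦ hnK q (Nat.primeFactors_mono hmn hn0 hq)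
  have hℓp : ℓ.Prime := hℓK.1
  have hℓ0 : ℓ ≠ 0 := hℓp.ne_zero
  have hℓpf : ℓ ∉ n.primeFactors := fun h ↦ hℓn (Nat.dvd_of_mem_primeFactors h)
  have hN : Squarefree (n * ℓ) :=
    (Nat.squarefree_mul ((Nat.Prime.coprime_iff_not_dvd hℓp).mpr hℓn).symm).mpr ⟨hn, hℓp.squarefree⟩
  have hNpf : (n * ℓ).primeFactors = insert ℓ n.primeFactors := by
    rw [Nat.primeFactors_mul hn0 hℓ0, hℓp.primeFactors, Finset.union_comm, ← Finset.insert_eq]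
  have hNcard : (n * ℓ).primeFactors.card = n.primeFactors.card + 1 := by
    rw [hNpf, Finset.card_insert_of_notMem hℓpf]
  have hNK' : ∀ q ∈ (n * ℓ).primeFactors, Zhang2014.IsKolyvaginPrime (W.conductorNorm ℤ) W K 2 q ∧
      M ≤ Zhang2014.kolyvaginIndex W 2 q := by
    intro q hq
    rw [hNpf, Finset.mem_insert] at hq
    rcases hq with rfl | hq
    · exact ⟨hℓK, Nat.le_of_succ_le hℓI⟩
    · exact hnK' q hq
  -- (1) the kernel sign law at conductors `n` and `n ℓ`: `ε(nℓ) = −ε(n)`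
  obtain ⟨hs, hcs⟩ := GenusExact.KolyvaginClassSign.sign_conjAct_kolyvaginClass_two hK hne3 hne4 hodd hHN h2 τ hτ1
    Dt β ι hn hM hnK' d
  obtain ⟨-, hdups⟩ := GenusExact.KolyvaginClassSign.sign_conjAct_kolyvaginClass_two hK hne3 hne4 hodd hHN h2 τ
    hτ1 Dt β ι hN hM hNK' dup
  have hsℓ : -W.rootNumber * (-1) ^ (n * ℓ).primeFactors.card = -(-W.rootNumber * (-1) ^ n.primeFactors.card) := by
    rw [hNcard, pow_succ]
    ring
  rw [hsℓ] at hdups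
  -- (2) the sign squeeze: either `u = ε(n)` (main case) or `2 c_M(n) = 0`, which contradicts the visibility hypotheses
  by_cases hus : u = -W.rootNumber * (-1) ^ n.primeFactors.card
  swap
  · exfalso
    have h2c : (2 : ℤ) • d.kolyvaginClass Nat.prime_two M = 0 :=
      two_zsmul_eq_zero_of_sign_mismatch hu hs hus (hcτ.symm.trans hcs)
    have hb0 : b = 0 := by
      by_contra hb
      refine hcb ?_
      rw [two_pow_zsmul_eq_zero_of_le_swap (Nat.one_le_iff_ne_zero.mpr hb)
        (by rw [pow_one, Nat.cast_ofNat]; exact h2c)]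
      exact zero_mem _
    have hMa : M ≤ a := by omega
    have hMz : ((2 ^ M : ℕ) : ℤ) • z = 0 := zsmul_galH1Torsion_eq_zero (W.baseChange K) _ z
    refine hza ?_
    rw [two_pow_zsmul_eq_zero_of_le_swap hMa hMz]
    exact zero_mem _
  -- main case: `z` and `c_M(nℓ)` have the same sign `−u`
  have hε : -u = 1 ∨ -u = -1 := by
    rcases hu with rfl | rfl
    · exact Or.inr rfl
    · exact Or.inl (neg_neg 1)
  have hdupτ : conjAct W τ ((2 ^ M : ℕ) : ℤ) (dup.kolyvaginClass Nat.prime_two M) =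
      (-u) • dup.kolyvaginClass Nat.prime_two M := by rw [hdups, hus]
  -- (3) the frame: `τ² = 1`, instances, Poitou–Tate families (tree theorem), Weil data, hybrid structures
  have hττ : τ * τ = 1 := mul_self_eq_one_of_isImaginaryQuadratic hK τ
  haveI : (W.baseChange K).IsElliptic := by rw [baseChange]; infer_instance
  haveI hNZ : ∀ M : ℕ, NeZero (2 ^ M) := fun M ↦ ⟨pow_ne_zero M two_ne_zero⟩
  haveI : ∀ M : ℕ, Finite (geomTorsion (W.baseChange K) ((2 ^ M : ℕ) : ℤ)) := fun M ↦
    finite_geomTorsion_of_neZero (W.baseChange K) (2 ^ M)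
  have hinv : ∀ M : ℕ, ∃ inv : LocalInvariants K (2 ^ M), inv.IsPerfect ∧ inv.SumLocalTermEqZero ∧
      inv.UnramifiedOrthogonal ∧ inv.SelmerComplement ∧ ∀ σ : K ≃ₐ[ℚ] K, inv.IsConjCompatible σ :=
    fun M ↦ InputsPoitouTateSelmer.poitouTate_selmerStructure_duality_conj_holds K (2 ^ M)
  choose inv hperf hvan hUO hSC hconj using hinv
  have hweil := fun M : ℕ ↦ exists_weilDatum_liftAut_two_pow (K := K) W τ M
  choose e hμ hadd₁ hadd₂ hgal halt hnondeg hτe using hweil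
  have hhyb := fun M : ℕ ↦ exists_hybridTransverseFamily (K := K) W ι M
  choose 𝒯 hTko hTku using hhyb
  -- (4) the sibling currency: `H_{𝓕(m)} = H¹_{selmerF 𝒯_M (placesDividing m)}` (JET's global transverse family mediates)
  have hz' : z ∈ (selmerF W ((2 ^ M : ℕ) : ℤ) (𝒯 M) (placesDividing K m)).selmerGroup := by
    obtain ⟨𝒯g, h𝒯g, -⟩ := JET.Walk.exists_globalTransverseFamily W ι ((2 ^ M : ℕ) : ℤ)
    have heq : selmerF W ((2 ^ M : ℕ) : ℤ) (𝒯 M) (placesDividing K m) =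
        selmerF W ((2 ^ M : ℕ) : ℤ) 𝒯g (placesDividing K m) :=
      KolyvaginAtTwo.RegularRefill.selmerF_eq_of_forall_eq W ((2 ^ M : ℕ) : ℤ) (𝒯 M) 𝒯g (placesDividing K m)
        fun w hw ↦ by
          obtain ⟨q, hqm, hqw⟩ := (natCast_mem_iff_exists_primeFactor_mem hm0 w).mp
            ((mem_placesDividing_iff_natCast_mem hm0 w).mp hw)
          rw [hTko M w q (hmK q hqm).1 (hmK q hqm).2 hqw,
            JET.Walk.globalTransverse_eq_of_natCast_mem h𝒯g w (hmK q hqm).1.1 hqw]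
    rw [heq, selmerGroup_selmerF_eq_modifiedSelmerGroup W ι ((2 ^ M : ℕ) : ℤ) 𝒯g hm0
      (JET.Walk.globalTransverse_mem_iff h𝒯g (hn.squarefree_of_dvd hmn))]
    exact hz
  -- (5) the core on the hybrid frame
  exact oppositeSignReciprocityAtTwo_core_hybrid (W := W) (τ := τ) (Dt := Dt) (β := β) (ι := ι) (e := e)
    (hμ := hμ) (hadd₁ := hadd₁) (hadd₂ := hadd₂) (hgal := hgal) (halt := halt) (hnondeg := hnondeg) (hτe := hτe)
    (inv := inv) (𝒯 := 𝒯) (hCM := hCM) (hsur := hsur) (hK := hK) (hne3 := hne3) (hne4 := hne4) (hHN := hHN)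
    (hτ1 := hτ1) (hττ := hττ) (hperf := hperf) (hvan := hvan) (hinvc := fun M ↦ hconj M τ) (hTko := hTko)
    (hTku := hTku) (h37 := h37) d dup z v hM hn hnK hmn hℓK hℓn hℓI hv hε hz' hzτ hdupτ hza hcb (by omega) hσ hS
    hS' hemb

end Typed

end Summit.BirchSwinnertonDyer.BirchSwinnertonDyer.Theorems.KolyvaginLowerBoundAtTwo

end
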